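import Mathlib
import HarnessLib
import Summits.RiemannHypothesis.Statement
import Summits.RiemannHypothesis.RiemannHypothesis.Theorems.SuzukiWindowsDoorConverseRH
import Summits.RiemannHypothesis.RiemannHypothesis.Theorems.DeBrangesSuzukiDoorDoorModuloKernel
import Literature.NumberTheory.LFunctions.SuzukiSingleOperatorKernelProofs

/-!
# RiemannHypothesis / de Branges–Suzuki door — EVERY non-zero `f ∈ L²(−1,1)` is a door witness, file 1/2:
the door argument with a general weight and the weighted Laplace factorisation (RH-FREE; zero definitions)

Cell rh-split, seat dbr/finite gen 2 (`HOME/rh-split-dbr-finite/SketchG2.lean` sha16 1447610eece51980, §P1), RAW-ified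
and filed by rh-split-typer-2 g2: the seat's objects `windowImage K 1 f` (`x ↦ ∫_{(−1,1)} K(x+y) f(y) dy`), `reflectWindow f`
(`1_{(−1,1)}(u) f(−u)`), `windowSymbol f` (`F♯_f(z) = ∫ 1_{(−1,1)}(u) f(−u) e^{izu} du`), `imageLaplace θ f`
(`G_f(z) = ∫ (𝖪_θ[1] f)(u) e^{izu} du`) and the Props P1/P1a/P1b are WRITTEN OUT in every statement.
The tree's door `witnessDetectsRH_proof` / `SuzukiWindowsDoor.rh_of_window_memLp` has the witness `1_{(0,1)}`; p467879 widened
it to integer-grid step inputs; here (assembled in file 2/2, `rh_of_windowWitness`): for `θ > 10`, EVERY `f ∈ L²(−1,1)` not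
a.e. zero with `x ↦ ∫_{(−1,1)} K_θ(x+y) f(y) dy ∈ L²(ℝ)` proves RH.  This file:
* `everyWitnessDetectsRH_of` — P1 from P1a ∧ P1b: holomorphy on `ℂ₊` of both Laplace transforms (tree
  `SuzukiDoor.differentiableOn_laplace_of_memLp`, `K_θ = 0` on the negatives [Su20] Thm 1.2 (K-iii)), symbol rigidity
  `SuzukiDoor.rh_of_symbolQuotientOn`;
* **P1a** `weightedLaplaceFactorisation` — `Θ_θ(z) · F♯_f(z) = G_f(z)` on `Im z > 1` for every `θ > 1` (weighted Fubini as
  in [Su20] arXiv:1907.07302 p.6, proof of (K-v); absolute convergence from `abs_limKernel_le_exp`);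
* `everyWitnessDetectsRH_of_nonvanishing` — P1 modulo P1b alone.
Typer-2 g2 replay of the combined raw file: rc 0 / 0 warnings / 0 sorry, `#print axioms rh_of_windowWitness` = std.
RH-FREE implications about an RH-EQUIVALENT criterion; SPLITTING SEARCH bookkeeping; nothing in this file bears on the truth of RH.
-/

noncomputable section

set_option linter.dupNamespace false

namespace Summit.RiemannHypothesis.RiemannHypothesis.Theorems.SuzukiDoorEveryWitness

open MeasureTheory Set Complex Filter
open scoped Topology
open Literature.NumberTheory.LFunctions (NoUnitEigenvalue limKernel limTheta Suzuki2020_thm12_continuous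
  Suzuki2020_thm12_Kiii)

/-! ## P1 reduced: weighted Laplace factorisation + window-symbol non-vanishing ⟹ `EveryWitnessDetectsRH θ` -/

/-- `reflectWindow f ∈ L²(ℝ)` for `f ∈ L²(−1,1)` (zero-extension + the measure-preserving reflection `u ↦ −u`). -/
theorem memLp_reflectWindow {f : ℝ → ℝ} (hf : MemLp f 2 (volume.restrict (Ioo (-1) 1))) :
    MemLp (((Ioo (-1 : ℝ) 1).indicator (fun u => f (-u)))) 2 volume := by
  have h1 : MemLp ((Ioo (-1 : ℝ) 1).indicator f) 2 (volume : Measure ℝ) :=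
    (memLp_indicator_iff_restrict measurableSet_Ioo).mpr hf
  have h2 : MemLp (fun u : ℝ => (Ioo (-1 : ℝ) 1).indicator f (-u)) 2 (volume : Measure ℝ) :=
    h1.comp_measurePreserving (Measure.measurePreserving_neg (volume : Measure ℝ))
  refine h2.congr_norm ?_ (Eventually.of_forall fun u => ?_)
  · refine (h2.aestronglyMeasurable.congr (Eventually.of_forall fun u => ?_))
    show (Ioo (-1 : ℝ) 1).indicator f (-u) = ((Ioo (-1 : ℝ) 1).indicator (fun u => f (-u)) u)
    simp only [Set.indicator]
    have : (-u ∈ Ioo (-1 : ℝ) 1) ↔ (u ∈ Ioo (-1 : ℝ) 1) := by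
      simp only [mem_Ioo]; constructor <;> rintro ⟨h₁, h₂⟩ <;> constructor <;> linarith
    by_cases hu : u ∈ Ioo (-1 : ℝ) 1
    · rw [if_pos (this.mpr hu), if_pos hu]
    · rw [if_neg (fun h => hu (this.mp h)), if_neg hu]
  · simp only [Set.indicator]
    have : (-u ∈ Ioo (-1 : ℝ) 1) ↔ (u ∈ Ioo (-1 : ℝ) 1) := by
      simp only [mem_Ioo]; constructor <;> rintro ⟨h₁, h₂⟩ <;> constructor <;> linarith
    by_cases hu : u ∈ Ioo (-1 : ℝ) 1
    · rw [if_pos (this.mpr hu), if_pos hu]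
    · rw [if_neg (fun h => hu (this.mp h)), if_neg hu]

/-- **P1 from P1a ∧ P1b** (RH-FREE; the tree's door argument verbatim with a general weight): `G_f` is holomorphic on `ℂ₊`
because the window image vanishes on `(−∞,−1]` (`K_θ = 0` on the negatives, [Su20] Thm 1.2 (K-iii)) and is in `L²`;
`F♯_f` is holomorphic on `ℂ₊` and `≢ 0`; `Θ_θ F♯_f = G_f` on `Im z > 1`; symbol rigidity `rh_of_symbolQuotientOn`. -/
theorem everyWitnessDetectsRH_of {θ : ℝ} (hθ : 10 < θ) (hF : (∀ f : ℝ → ℝ, MemLp f 2 (volume.restrict (Ioo (-1) 1)) →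
    ∀ z : ℂ, 1 < z.im → limTheta θ z * (∫ u : ℝ, (((Ioo (-1 : ℝ) 1).indicator (fun u => f (-u)) u : ℝ) : ℂ) * Complex.exp (I * z * (u : ℂ))) = (∫ u : ℝ, ((∫ y in Ioo (-1:ℝ) 1, limKernel θ (u + y) * f y : ℝ) : ℂ) * Complex.exp (I * z * (u : ℂ)))))
    (hN : (∀ f : ℝ → ℝ, MemLp f 2 (volume.restrict (Ioo (-1) 1)) →
    ¬ (f =ᵐ[volume.restrict (Ioo (-1) 1)] 0) → ∃ z : ℂ, 0 < z.im ∧ (∫ u : ℝ, (((Ioo (-1 : ℝ) 1).indicator (fun u => f (-u)) u : ℝ) : ℂ) * Complex.exp (I * z * (u : ℂ))) ≠ 0)) : (∀ f : ℝ → ℝ, MemLp f 2 (volume.restrict (Ioo (-1) 1)) →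
    ¬ (f =ᵐ[volume.restrict (Ioo (-1) 1)] 0) →
    MemLp (fun x : ℝ => ∫ y in Ioo (-1:ℝ) 1, limKernel θ (x + y) * f y) 2 volume → _root_.RiemannHypothesis) := by
  intro f hf hne hmem
  have h0 : ∀ x : ℝ, x < 0 → limKernel θ x = 0 := fun x hx => Suzuki2020_thm12_Kiii (by linarith) hx
  have hW0 : ∀ u : ℝ, u ≤ -1 → (∫ y in Ioo (-1:ℝ) 1, limKernel θ (u + y) * f y) = 0 := by
    intro u hu
    refine setIntegral_eq_zero_of_forall_eq_zero fun y hy => ?_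
    rw [h0 (u + y) (by have := hy.2; linarith), zero_mul]
  have hG : DifferentiableOn ℂ ((fun z : ℂ => ∫ u : ℝ, ((∫ y in Ioo (-1:ℝ) 1, limKernel θ (u + y) * f y : ℝ) : ℂ) * Complex.exp (I * z * (u : ℂ)))) {z : ℂ | 0 < z.im} :=
    Theorems.SuzukiDoor.differentiableOn_laplace_of_memLp hmem hW0
  have hR0 : ∀ u : ℝ, u ≤ -1 → ((Ioo (-1 : ℝ) 1).indicator (fun u => f (-u)) u) = 0 := fun u hu =>
    Set.indicator_of_notMem (by simp only [mem_Ioo, not_and, not_lt]; intro h; linarith) _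
  have hFd : DifferentiableOn ℂ ((fun z : ℂ => ∫ u : ℝ, (((Ioo (-1 : ℝ) 1).indicator (fun u => f (-u)) u : ℝ) : ℂ) * Complex.exp (I * z * (u : ℂ)))) {z : ℂ | 0 < z.im} :=
    Theorems.SuzukiDoor.differentiableOn_laplace_of_memLp (memLp_reflectWindow hf) hR0
  obtain ⟨z₀, hz₀, hne₀⟩ := hN f hf hne
  have hGF : ∀ z : ℂ, (1 : ℝ) < z.im → Theorems.SuzukiDoor.limTheta θ z * (∫ u : ℝ, (((Ioo (-1 : ℝ) 1).indicator (fun u => f (-u)) u : ℝ) : ℂ) * Complex.exp (I * z * (u : ℂ))) = (∫ u : ℝ, ((∫ y in Ioo (-1:ℝ) 1, limKernel θ (u + y) * f y : ℝ) : ℂ) * Complex.exp (I * z * (u : ℂ))) :=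
    fun z hz => by rw [Theorems.SuzukiWindowsDoorConverse.limTheta_eq_lit]; exact hF f hf z hz
  exact Theorems.SuzukiDoor.rh_of_symbolQuotientOn (θ := θ) (a := 1) (by linarith) (by norm_num) hG hFd
    ⟨z₀, hz₀, hne₀⟩ hGF

/-! ## P1a PROVED (RH-FREE): the weighted Laplace factorisation, for every `θ > 1` -/

/-- The window symbol as a set integral: `F♯_f(z) = ∫_{(−1,1)} f(y) e^{−izy} dy` (reflection `u ↦ −u`, Lebesgue measure is
negation invariant). -/
theorem windowSymbol_eq_setIntegral (f : ℝ → ℝ) (z : ℂ) :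
    (∫ u : ℝ, (((Ioo (-1 : ℝ) 1).indicator (fun u => f (-u)) u : ℝ) : ℂ) * Complex.exp (I * z * (u : ℂ))) = ∫ y in Ioo (-1 : ℝ) 1, (f y : ℂ) * Complex.exp (-(I * z) * (y : ℂ)) := by
  set h : ℝ → ℂ := fun y => (Ioo (-1 : ℝ) 1).indicator (fun y => (f y : ℂ) * Complex.exp (-(I * z) * (y : ℂ))) y
    with hh_def
  have h1 : (fun u : ℝ => (((Ioo (-1 : ℝ) 1).indicator (fun u => f (-u)) u : ℝ) : ℂ) *
      Complex.exp (I * z * (u : ℂ))) = fun u : ℝ => h (-u) := by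
    funext u
    simp only [hh_def]
    by_cases hu : u ∈ Ioo (-1 : ℝ) 1
    · have hnu : -u ∈ Ioo (-1 : ℝ) 1 := by
        simp only [mem_Ioo] at hu ⊢; constructor <;> linarith
      rw [indicator_of_mem hu, indicator_of_mem hnu]
      congr 1
      push_cast
      ring_nf
    · have hnu : -u ∉ Ioo (-1 : ℝ) 1 := fun h' => hu (by
        simp only [mem_Ioo] at h' ⊢; constructor <;> linarith)
      rw [indicator_of_notMem hu, indicator_of_notMem hnu]
      simp
  rw [h1, integral_neg_eq_self h volume, hh_def, integral_indicator measurableSet_Ioo]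

/-- **P1a PROVED** (RH-FREE; [Su20] arXiv:1907.07302 Thm 1.2 (K-ii),(K-iii) via the tree's `Suzuki2020_thm12_fourier`,
`Suzuki2020_thm12_Kiii`, growth `abs_limKernel_le_exp`; Fubini with the weight `f ∈ L²(−1,1) ⊂ L¹(−1,1)`): for `θ > 1`
and `Im z > 1`, `Θ_θ(z) F♯_f(z) = G_f(z)`. -/
theorem weightedLaplaceFactorisation {θ : ℝ} (hθ : 1 < θ) : (∀ f : ℝ → ℝ, MemLp f 2 (volume.restrict (Ioo (-1) 1)) →
    ∀ z : ℂ, 1 < z.im → limTheta θ z * (∫ u : ℝ, (((Ioo (-1 : ℝ) 1).indicator (fun u => f (-u)) u : ℝ) : ℂ) * Complex.exp (I * z * (u : ℂ))) = (∫ u : ℝ, ((∫ y in Ioo (-1:ℝ) 1, limKernel θ (u + y) * f y : ℝ) : ℂ) * Complex.exp (I * z * (u : ℂ)))) := by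
  intro f hf z hz
  have hKc : Continuous (limKernel θ) := Suzuki2020_thm12_continuous hθ
  have hK0 : ∀ x : ℝ, x < 0 → limKernel θ x = 0 := fun x hx => Suzuki2020_thm12_Kiii hθ hx
  obtain ⟨-, hKF⟩ := Literature.NumberTheory.LFunctions.Suzuki2020_thm12_fourier hθ
    (by linarith : 1 / 2 < z.im)
  set C : ℝ := 1 / (2 * Real.pi) * ∫ u : ℝ, ‖limTheta θ ((u : ℂ) + ((1 : ℝ) : ℂ) * I)‖ with hC_def
  have hC : ∀ x : ℝ, |limKernel θ x| ≤ C * Real.exp (1 * x) := fun x =>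
    Theorems.SuzukiDoor.abs_limKernel_le_exp θ x
  have hC0 : 0 ≤ C := mul_nonneg (by positivity) (integral_nonneg fun _ => norm_nonneg _)
  have hb : 1 < z.im := hz
  set S : Set ℝ := Ioo (-1 : ℝ) 1 with hS_def
  haveI : IsFiniteMeasure (volume.restrict S) := by
    refine ⟨?_⟩
    rw [Measure.restrict_apply_univ, hS_def, Real.volume_Ioo]
    exact ENNReal.ofReal_lt_top
  have hfi : Integrable f (volume.restrict S) := hf.integrable one_le_two
  set F : ℝ → ℝ → ℂ := fun u y =>
    (limKernel θ (u + y) : ℂ) * (f y : ℂ) * Complex.exp (I * z * (u : ℂ)) with hF_def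
  have h1 : ∀ u : ℝ, (((∫ y in Ioo (-1:ℝ) 1, limKernel θ (u + y) * f y) : ℝ) : ℂ) * Complex.exp (I * z * (u : ℂ)) =
      ∫ y in S, F u y := by
    intro u
    simp only [hF_def]
    rw [← integral_complex_ofReal, ← integral_mul_const]
    congr 1
    funext y
    push_cast
    ring
  have hae : ∀ᵐ p : ℝ × ℝ ∂((volume : Measure ℝ).prod (volume.restrict S)), p.2 ∈ S := by
    have hμ : (volume : Measure ℝ).prod (volume.restrict S) =
        ((volume : Measure ℝ).prod volume).restrict (univ ×ˢ S) := by
      rw [← Measure.prod_restrict, Measure.restrict_univ]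
    rw [hμ]
    filter_upwards [ae_restrict_mem (MeasurableSet.univ.prod measurableSet_Ioo)] with p hp
    exact hp.2
  have hg₁ : Integrable (fun u : ℝ => (Ioi (-1 : ℝ)).indicator
      (fun u => C * Real.exp 1 * Real.exp (-(z.im - 1) * u)) u) := by
    have hc' : IntegrableOn (fun u : ℝ => C * Real.exp 1 * Real.exp (-(z.im - 1) * u))
        (Ioi (-1 : ℝ)) volume :=
      (exp_neg_integrableOn_Ioi (-1) (by linarith : 0 < z.im - 1)).const_mul (C * Real.exp 1)
    exact hc'.integrable_indicator measurableSet_Ioi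
  have hprod : Integrable (fun p : ℝ × ℝ => (Ioi (-1 : ℝ)).indicator
      (fun u => C * Real.exp 1 * Real.exp (-(z.im - 1) * u)) p.1 * (fun y : ℝ => |f y|) p.2)
      ((volume : Measure ℝ).prod (volume.restrict S)) :=
    hg₁.mul_prod hfi.abs
  have hint : Integrable (Function.uncurry F) ((volume : Measure ℝ).prod (volume.restrict S)) := by
    refine hprod.mono' ?_ ?_
    · have hc1 : Continuous fun p : ℝ × ℝ => (limKernel θ (p.1 + p.2) : ℂ) :=
        Complex.continuous_ofReal.comp (hKc.comp (continuous_fst.add continuous_snd))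
      have hc2 : Continuous fun p : ℝ × ℝ => Complex.exp (I * z * (p.1 : ℂ)) := by fun_prop
      have hfm : AEStronglyMeasurable (fun p : ℝ × ℝ => (f p.2 : ℂ))
          ((volume : Measure ℝ).prod (volume.restrict S)) :=
        (Complex.continuous_ofReal.comp_aestronglyMeasurable hf.1).comp_snd
      exact (hc1.aestronglyMeasurable.mul hfm).mul hc2.aestronglyMeasurable
    · filter_upwards [hae] with p hp
      rcases p with ⟨u, y⟩
      have hy : y ∈ S := hp
      have hy1 : y < 1 := by simp only [hS_def, mem_Ioo] at hy; exact hy.2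
      simp only [Function.uncurry_apply_pair, hF_def]
      rw [norm_mul, norm_mul, Complex.norm_real, Complex.norm_real,
        Theorems.SuzukiDoor.norm_cexp_I_mul_mul_ofReal, Real.norm_eq_abs, Real.norm_eq_abs]
      by_cases hu : u ≤ -1
      · have : limKernel θ (u + y) = 0 := hK0 _ (by linarith)
        rw [this, abs_zero, zero_mul, zero_mul]
        exact mul_nonneg (Set.indicator_nonneg (fun _ _ => by positivity) _) (abs_nonneg _)
      · rw [indicator_of_mem (show u ∈ Ioi (-1 : ℝ) from lt_of_not_ge hu)]
        have hK1 : |limKernel θ (u + y)| ≤ C * Real.exp 1 * Real.exp u := by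
          calc |limKernel θ (u + y)| ≤ C * Real.exp (1 * (u + y)) := hC (u + y)
            _ ≤ C * Real.exp (1 + u) := by gcongr; linarith
            _ = C * Real.exp 1 * Real.exp u := by rw [Real.exp_add]; ring
        have hEq : Real.exp u * Real.exp (-(z.im * u)) = Real.exp (-(z.im - 1) * u) := by
          rw [← Real.exp_add]; ring_nf
        calc |limKernel θ (u + y)| * |f y| * Real.exp (-(z.im * u))
            ≤ C * Real.exp 1 * Real.exp u * |f y| * Real.exp (-(z.im * u)) := by gcongr
          _ = C * Real.exp 1 * (Real.exp u * Real.exp (-(z.im * u))) * |f y| := by ring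
          _ = C * Real.exp 1 * Real.exp (-(z.im - 1) * u) * |f y| := by rw [hEq]
  have hL : (∫ u : ℝ, ((∫ y in Ioo (-1:ℝ) 1, limKernel θ (u + y) * f y : ℝ) : ℂ) * Complex.exp (I * z * (u : ℂ))) = ∫ u, ∫ y in S, F u y := by
    exact integral_congr_ae (ae_of_all _ h1)
  have h4 : ∀ y : ℝ, ∫ u : ℝ, F u y = limTheta θ z * ((f y : ℂ) * Complex.exp (-(I * z) * (y : ℂ))) := by
    intro y
    set g : ℝ → ℂ := fun x => (limKernel θ x : ℂ) * Complex.exp (I * z * (x : ℂ)) *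
      ((f y : ℂ) * Complex.exp (-(I * z) * (y : ℂ))) with hg_def
    have hfg : (fun u => F u y) = fun u => g (u + y) := by
      funext u
      simp only [hF_def, hg_def]
      have he : Complex.exp (I * z * ((u + y : ℝ) : ℂ)) * Complex.exp (-(I * z) * (y : ℂ)) =
          Complex.exp (I * z * (u : ℂ)) := by
        rw [← Complex.exp_add]
        congr 1
        push_cast
        ring
      calc (limKernel θ (u + y) : ℂ) * (f y : ℂ) * Complex.exp (I * z * (u : ℂ))
          = (limKernel θ (u + y) : ℂ) * (f y : ℂ) *
              (Complex.exp (I * z * ((u + y : ℝ) : ℂ)) * Complex.exp (-(I * z) * (y : ℂ))) := by rw [he]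
        _ = _ := by ring
    rw [hfg, integral_add_right_eq_self g y, hg_def, integral_mul_const, hKF]
  rw [windowSymbol_eq_setIntegral, hL, integral_integral_swap hint]
  simp_rw [h4]
  rw [integral_const_mul]

/-- So P1 holds modulo P1b alone (θ > 10 for the door). -/
theorem everyWitnessDetectsRH_of_nonvanishing {θ : ℝ} (hθ : 10 < θ) (hN : (∀ f : ℝ → ℝ, MemLp f 2 (volume.restrict (Ioo (-1) 1)) →
    ¬ (f =ᵐ[volume.restrict (Ioo (-1) 1)] 0) → ∃ z : ℂ, 0 < z.im ∧ (∫ u : ℝ, (((Ioo (-1 : ℝ) 1).indicator (fun u => f (-u)) u : ℝ) : ℂ) * Complex.exp (I * z * (u : ℂ))) ≠ 0)) :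
    (∀ f : ℝ → ℝ, MemLp f 2 (volume.restrict (Ioo (-1) 1)) →
    ¬ (f =ᵐ[volume.restrict (Ioo (-1) 1)] 0) →
    MemLp (fun x : ℝ => ∫ y in Ioo (-1:ℝ) 1, limKernel θ (x + y) * f y) 2 volume → _root_.RiemannHypothesis) :=
  everyWitnessDetectsRH_of hθ (weightedLaplaceFactorisation (by linarith)) hN

end Summit.RiemannHypothesis.RiemannHypothesis.Theorems.SuzukiDoorEveryWitness

end
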